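import Literature.NumberTheory.GelbartRogawski1991.DoubledWeilRepresentationUniqueness
import Literature.NumberTheory.GelbartRogawski1991.DoubledUnitaryAdaptedSiegelDet
import Literature.NumberTheory.Automorphic.UnitaryGroupAdelicDet
import Literature.NumberTheory.Automorphic.UnitaryGroupGlobalGenericity
import HarnessLib

-- buildfix G11b-3 recipe (LEDGER B13-1/B13-3): elaborate sequentially so the trailing `attribute [implicit_reducible]`
-- block (reducibilityCoreExt is keyed to the async environment branch) is in force at `.olean` export.
set_option Elab.async false

/-!
# Determinant twists of the doubled Weil representation `s_D` (Gelbart–Rogawski §3.1 Remark p. 457; Kudla §3)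

Topic `NumberTheory/GelbartRogawski1991`; namespace `Literature.NumberTheory.GelbartRogawski1991.GRConstruction`
(sub-namespace `DoubledWeilDetTwist`).  KERNEL only: definitions with bodies and proved theorems, no named fact, no `sorry`.

Setting of `DoubledUnitaryGlobalSplittingData` (CM field `L`, `L⁺ = Fp L`, real non-zero diagonal hermitian data `dV`, `dW`,
the doubled group `H = U(J^𝔻)`, `HA = H(𝔸_{L⁺})`, `MpD = Mp(𝕎^𝔻)ᶜᵒⁿᵗ`, the Siegel parabolic `P_Δ` = `IsSiegelDelta`, Kudla's
`x(p) = det_Δ p` = `detDelta`, and the prescription `IsDoubledWeilRep χ sD`).  Results: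

* `detH` = `UnitaryGroup.adelicDet` at the doubled form; `idelesRatio` = the Hilbert-90 map `𝕀_L →* U(1)(𝔸_{L⁺})`, `d ↦ d / d̄`;
  **`detH_eq_idelesRatio_of_isSiegelDelta`**: `det p = x(p) / x(p)‾` on `P_Δ` ([Kudla1994, §3]; [HarrisKudlaSweet1996, (1.11)–(1.12)]);
* **`IsDoubledWeilRep.twist`** ∕ **`.detTwist`**: `sD ⊗ θ` carries the prescription for `χ'` when `χ'(x(p)) = θ(p) χ(x(p))` on `P_Δ(𝔸)`,
  in particular for `θ = α ∘ det`, `χ' = χ · (α ∘ idelesRatio)`; **`eq_detTwist`**: by `isDoubledWeilRep_unique` ANY `χ'`-normalised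
  `sD'` IS `sD ⊗ (α ∘ det)` ([GelbartRogawski1991, §3.1 Remark p. 457 L9–13], the direction «`χ ↦ χ·α̃` twists `s` by `α ∘ det`»);
* **`undoubleHom_twist`**: `undoubleHom (sD ⊗ θ) = undoubleHom sD ⊗ (θ ∘ inlG)` (`undouble_unique`), `detH ∘ inlG = det` (`coe_detH_inlG`);
  §6 `ratioHecke`: `α̃ = α ∘ idelesRatio` is a Hecke character for automorphic `α`, trivial on `𝕀_{L⁺}`.

## References
S. Gelbart, J. Rogawski, Invent. Math. 105 (1991) 445–472, §3.1 Prop. 3.1.1 p. 455, Remark p. 457 L4–13 [GelbartRogawski1991];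
S. Kudla, Israel J. Math. 87 (1994) 361–401, §3 [Kudla1994]; M. Harris, S. Kudla, W. J. Sweet, J. AMS 9 (1996) 941–1004,
§1 (1.11)–(1.15) [HarrisKudlaSweet1996].
Provenance: pub-hodgecm2 cell (COR-CM, Hodge ladder stage 2), seat pin-3 (Δ2/X3 co-owner), X3-Char residual item (C): the det-twist
bookkeeping behind «every compatible splitting of `U(𝕍)(𝔸)` is `ι_μ` for a character `μ`» (the other input — central characters of
`U(𝕍)(𝔸)/U(𝕍)(L⁺)` factor through `det` — is NOT proved here).  HC_CM is NOT proved here or anywhere in the tree.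
-/

set_option autoImplicit false

noncomputable section

open scoped Classical
open scoped Matrix Kronecker TensorProduct
open NumberField IsDedekindDomain
open Literature.RepresentationTheory.HeisenbergGroup
open Literature.NumberTheory.Automorphic
open Literature.NumberTheory.Weil1964
open Literature.RepresentationTheory.HarrisKudlaSweet1996
open Literature.NumberTheory.GaloisRepresentations

namespace Literature.NumberTheory.GelbartRogawski1991.GRConstruction

open UnitaryDualPair

variable (L : Type) [Field L] [NumberField L] [IsCMField L]

variable {N M n : ℕ} (e : Fin N × Fin M ≃ Fin n)
  (dV : Fin N → L) (hdV : ∀ i, IsCMField.complexConj L (dV i) = dV i) (hdV0 : ∀ i, dV i ≠ 0)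
  (dW : Fin M → L) (hdW : ∀ i, IsCMField.complexConj L (dW i) = dW i) (hdW0 : ∀ i, dW i ≠ 0)

namespace DoubledWeilDetTwist

local notation "𝔸L" => AdeleRing (𝓞 L) L

/-! ## §0 Elementary facts on `𝔸_L`: the conjugation is an involution (`2` is invertible by `Weil1964.invertibleTwoAdeleRing`) -/

/-- `(c ⊗ 1)² = 1` on `𝔸_L`. [cite: GelbartRogawski1991, §3.1 Remark p. 457 L4–13] -/
theorem conjAdele_conjAdele (x : 𝔸L) :
    UnitaryGroup.conjAdele (Fp L) L (IsCMField.complexConj L) (UnitaryGroup.conjAdele (Fp L) L (IsCMField.complexConj L) x) = x :=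
  UnitaryGroup.conjAdele_conjAdele (AlgEquiv.ext fun y => IsCMField.complexConj_apply_apply L y) x

/-- the conjugate idele `d̄ = (c ⊗ 1) d`. [cite: GelbartRogawski1991, §3.1 Remark p. 457 L4–13] -/
abbrev conjIdele : ideleGroup L →* ideleGroup L :=
  Units.map (UnitaryGroup.conjAdele (Fp L) L (IsCMField.complexConj L)).toMonoidHom
/-- `(d̄ : 𝔸_L) = (c ⊗ 1) d`. [cite: GelbartRogawski1991, §3.1 Remark p. 457 L4–13] -/
@[simp] theorem coe_conjIdele (d : ideleGroup L) :
    ((conjIdele L d : ideleGroup L) : 𝔸L) = UnitaryGroup.conjAdele (Fp L) L (IsCMField.complexConj L) (d : 𝔸L) := rfl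
/-- `d̄̄ = d`. [cite: GelbartRogawski1991, §3.1 Remark p. 457 L4–13] -/
@[simp] theorem conjIdele_conjIdele (d : ideleGroup L) : conjIdele L (conjIdele L d) = d :=
  Units.ext (conjAdele_conjAdele L (d : 𝔸L))

/-! ## §1 The Hilbert-90 map `𝕀_L → U(1)(𝔸_{L⁺})`, `d ↦ d / d̄` -/

/-- `d / d̄` is a norm-one idele. [cite: GelbartRogawski1991, §3.1 Remark p. 457 L4–13] -/
theorem div_conjIdele_mem_adelicOne (d : ideleGroup L) :
    d / conjIdele L d ∈ UnitaryGroup.adelicOne (Fp L) L (IsCMField.complexConj L) := by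
  rw [UnitaryGroup.mem_adelicOne_iff]
  have h : UnitaryGroup.conjAdele (Fp L) L (IsCMField.complexConj L) ((d / conjIdele L d : ideleGroup L) : 𝔸L) =
      ((conjIdele L d / d : ideleGroup L) : 𝔸L) := by
    rw [← coe_conjIdele, map_div, conjIdele_conjIdele]
  rw [h, ← Units.val_mul, div_mul_div_cancel, div_self', Units.val_one]

/-- **the Hilbert-90 map** `idelesRatio : 𝕀_L →* U(1)(𝔸_{L⁺})`, `d ↦ d / d̄`. [cite: GelbartRogawski1991, §3.1 Remark p. 457 L4–13] -/
def idelesRatio : ideleGroup L →* UnitaryGroup.adelicOne (Fp L) L (IsCMField.complexConj L) :=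
  MonoidHom.codRestrict ((MonoidHom.id (ideleGroup L)) / conjIdele L) _ fun d => div_conjIdele_mem_adelicOne L d
/-- formula: `(idelesRatio d : 𝕀_L) = d / d̄`. [cite: GelbartRogawski1991, §3.1 Remark p. 457 L4–13] -/
@[simp] theorem coe_idelesRatio (d : ideleGroup L) :
    ((idelesRatio L d : UnitaryGroup.adelicOne (Fp L) L (IsCMField.complexConj L)) : ideleGroup L) = d / conjIdele L d := rfl
/-- `d ↦ d̄` is continuous (`(c ⊗ 1)` is a continuous ring automorphism of `𝔸_L`). [cite: GelbartRogawski1991, §3.1 Remark p. 457 L4–13] -/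
theorem continuous_conjIdele : Continuous (conjIdele L) :=
  Continuous.units_map _ (AdeleRing.continuous_smul (Fp L) (IsCMField.complexConj L))
/-- `idelesRatio` is continuous. [cite: GelbartRogawski1991, §3.1 Remark p. 457 L4–13] -/
theorem continuous_idelesRatio : Continuous (idelesRatio L) := by
  refine Continuous.subtype_mk ?_ _
  change Continuous fun d : ideleGroup L => d / conjIdele L d
  exact continuous_id.div' (continuous_conjIdele L)

/-! ## §2 The determinant of the doubled group and its value on the Siegel parabolic -/

include hdV0 hdW0 in
/-- `det J^𝔻 ≠ 0`. [cite: Kudla1994, §3] -/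
theorem det_hermD_ne_zero : (hermD L e dV hdV dW hdW).det ≠ 0 := by
  rw [hermD, ← RingHom.mapMatrix_apply, ← RingHom.map_det]
  exact ((isUnit_det_gramD L e dV hdV hdV0 dW hdW hdW0).map _).ne_zero

/-- **`det : H(𝔸) →* U(1)(𝔸_{L⁺})`** on the doubled unitary group (the tree's `UnitaryGroup.adelicDet`). [cite: Kudla1994, §3] -/
def detH : HA L e dV hdV dW hdW →* UnitaryGroup.adelicOne (Fp L) L (IsCMField.complexConj L) :=
  UnitaryGroup.adelicDet (Fp L) L (IsCMField.complexConj L) (n + n) (hermD L e dV hdV dW hdW)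
    (det_hermD_ne_zero L e dV hdV hdV0 dW hdW hdW0)
/-- underlying adele of `detH h`: the matrix determinant. [cite: Kudla1994, §3] -/
theorem coe_coe_detH (h : HA L e dV hdV dW hdW) :
    (((detH L e dV hdV hdV0 dW hdW hdW0 h : UnitaryGroup.adelicOne (Fp L) L (IsCMField.complexConj L)) : ideleGroup L) : 𝔸L) =
      ((h : GL (Fin (n + n)) 𝔸L) : Matrix (Fin (n + n)) (Fin (n + n)) 𝔸L).det := rfl
/-- `detH` is continuous. [cite: Kudla1994, §3] -/
theorem continuous_detH : Continuous (detH L e dV hdV hdV0 dW hdW hdW0) :=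
  UnitaryGroup.continuous_adelicDet (Fp L) L (IsCMField.complexConj L) (n + n) (hermD L e dV hdV dW hdW) _


omit [IsCMField L] in
include hdV0 hdW0 in
/-- `det (J_V ⊗ 1) ⊗ₖ (J_W ⊗ 1)` re-enumerated by `e` is a unit of `𝔸_L`. [cite: Kudla1994, §3] -/
theorem isUnit_det_reindex_pairFormA : IsUnit (Matrix.reindex e e (pairFormA L dV dW)).det := by
  rw [Matrix.det_reindex_self, Matrix.det_kronecker]
  refine (IsUnit.pow _ ?_).mul (IsUnit.pow _ ?_)
  · exact UnitaryGroup.isUnit_det_adelicForm L N (Matrix.diagonal dV) (by rw [Matrix.det_diagonal]; exact Finset.prod_ne_zero_iff.2 fun i _ => hdV0 i)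
  · exact UnitaryGroup.isUnit_det_adelicForm L M (Matrix.diagonal dW) (by rw [Matrix.det_diagonal]; exact Finset.prod_ne_zero_iff.2 fun i _ => hdW0 i)

include hdV0 hdW0 in
/-- **Kudla's relation on the Siegel parabolic, adelically**: `det p · (c ⊗ 1)(x(p)) = x(p)` for `p ∈ P_Δ(𝔸)`,
`x(p) = det_Δ p` — the tree's `AdaptedBlocks.det_mul_map_det_deltaBlock_reindex` over the ring `𝔸_L` with the involution `c ⊗ 1`.
[cite: Kudla1994, §3] [cite: HarrisKudlaSweet1996, §1 (1.11)–(1.12)] -/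
theorem det_mul_conjAdele_detDelta (p : HA L e dV hdV dW hdW) (hp : IsSiegelDelta L e dV hdV dW hdW p) :
    ((p : GL (Fin (n + n)) 𝔸L) : Matrix (Fin (n + n)) (Fin (n + n)) 𝔸L).det *
        UnitaryGroup.conjAdele (Fp L) L (IsCMField.complexConj L) (detDelta L e dV hdV dW hdW p) =
      detDelta L e dV hdV dW hdW p := by
  have hM := mem_unitaryGroupOfForm_iff.1 p.2
  rw [adelicForm_hermD_eq L e dV hdV dW hdW] at hM
  exact AdaptedBlocks.det_mul_map_det_deltaBlock_reindex (σ := UnitaryGroup.conjAdele (Fp L) L (IsCMField.complexConj L))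
    (e₂ (n := n)) hM hp (isUnit_det_reindex_pairFormA L e dV hdV0 dW hdW0) (conjAdele_conjAdele L)

include hdV0 hdW0 in
/-- **`det p = x(p) / x(p)‾` on `P_Δ(𝔸)`**: for `p ∈ P_Δ(𝔸)` with `x(p) = det_Δ p` a unit (idele `u`), `detH p = idelesRatio u`.
[cite: Kudla1994, §3] [cite: HarrisKudlaSweet1996, §1 (1.11)–(1.12)] -/
theorem detH_eq_idelesRatio_of_isSiegelDelta (p : HA L e dV hdV dW hdW) (hp : IsSiegelDelta L e dV hdV dW hdW p)
    (hu : IsUnit (detDelta L e dV hdV dW hdW p)) :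
    detH L e dV hdV hdV0 dW hdW hdW0 p = idelesRatio L hu.unit := by
  have key : ((p : GL (Fin (n + n)) 𝔸L) : Matrix (Fin (n + n)) (Fin (n + n)) 𝔸L).det * ((conjIdele L hu.unit : ideleGroup L) : 𝔸L) =
      ((hu.unit : ideleGroup L) : 𝔸L) := by
    rw [coe_conjIdele, IsUnit.unit_spec]
    exact det_mul_conjAdele_detDelta L e dV hdV hdV0 dW hdW hdW0 p hp
  apply Subtype.ext
  apply Units.ext
  show ((p : GL (Fin (n + n)) 𝔸L) : Matrix (Fin (n + n)) (Fin (n + n)) 𝔸L).det = ((hu.unit / conjIdele L hu.unit : ideleGroup L) : 𝔸L)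
  rw [div_eq_mul_inv, Units.val_mul, ← key, mul_assoc, Units.mul_inv, mul_one]

/-- **`det (g ⊕ 1) = det g`**: on `U(𝕍)(𝔸) × 1 ⊂ H(𝔸)` the determinant of the doubled group is the determinant of
`G₁(𝔸) = U(J_V ⊗ J_W)(𝔸_{L⁺}) ≤ GL_{NM}(𝔸_L)`. [cite: Kudla1994, §3] -/
theorem coe_detH_inlG (g : UnitaryGroup.adelicPair (Fp L) L (IsCMField.complexConj L) N M (Matrix.diagonal dV) (Matrix.diagonal dW)) :
    ((((detH L e dV hdV hdV0 dW hdW hdW0 (inlG L e dV hdV dW hdW g) : UnitaryGroup.adelicOne (Fp L) L (IsCMField.complexConj L)) :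
        ideleGroup L) : 𝔸L)) =
      ((g : GL (Fin N × Fin M) 𝔸L) : Matrix (Fin N × Fin M) (Fin N × Fin M) 𝔸L).det := by
  rw [coe_coe_detH, coe_inlG, UnitaryGroup.coe_reindexGL, Matrix.det_reindex_self, UnitaryGroup.coe_blockDiagGL,
    Matrix.det_fromBlocks_zero₂₁, UnitaryGroup.coe_reindexGL, Matrix.det_reindex_self, Units.val_one, Matrix.det_one, mul_one]


/-! ## §3 Twisting the prescription: `sD ⊗ θ` is `χ'`-normalised when `χ'(x(p)) = θ(p) χ(x(p))` on `P_Δ(𝔸)` -/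

open DoubledWeilUniqueness in
include hdV0 hdW0 in
/-- **central twists of the doubled Weil representation.**  If `sD` is the doubled Weil representation with character `χ` and
`θ : H(𝔸) →* ℂˣ` is a continuous character with `χ'(x(p)) = θ(p) · χ(x(p))` for every `p ∈ P_Δ(𝔸)` (`x(p) = det_Δ p`), then `sD ⊗ θ`
is the doubled Weil representation with character `χ'` (continuity ∕ projection from `sD`; on `P_Δ(𝔸)` the value-at-the-origin
scalar is multiplied by `θ(p)`, `opD_conj_eq_mul_of_eq_ofScalar_mul`). [cite: GelbartRogawski1991, §3.1 Remark p. 457 L4–13] [cite: Kudla1994, §3 Thm. 3.1] -/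
theorem _root_.Literature.NumberTheory.GelbartRogawski1991.GRConstruction.IsDoubledWeilRep.twist
    {χ χ' : HeckeCharacter L} {sD : HA L e dV hdV dW hdW →* MpD L e dV hdV dW hdW}
    (h : IsDoubledWeilRep L e dV hdV hdV0 dW hdW hdW0 χ sD) (θ : HA L e dV hdV dW hdW →* ℂˣ)
    (hθ : Continuous fun p => ((θ p : ℂˣ) : ℂ))
    (hrel : ∀ (p : HA L e dV hdV dW hdW), IsSiegelDelta L e dV hdV dW hdW p → ∀ hu : IsUnit (detDelta L e dV hdV dW hdW p),
      ((χ' hu.unit : ℂˣ) : ℂ) = ((θ p : ℂˣ) : ℂ) * ((χ hu.unit : ℂˣ) : ℂ)) :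
    IsDoubledWeilRep L e dV hdV hdV0 dW hdW hdW0 χ' (adelicMpCont.twist (Fp L) (Fin (n + n)) (gramDA L e dV hdV dW hdW) sD θ) where
  continuous := adelicMpCont.continuous_twist sD θ h.continuous hθ
  proj_eq p := (adelicMpCont.proj_twist sD θ p).trans (h.proj_eq p)
  parabolic p hp hu Φ := by
    have e1 := opD_conj_eq_mul_of_eq_ofScalar_mul L e dV hdV hdV0 dW hdW hdW0 p (θ p) (adelicMpCont.twist_apply sD θ p) Φ 0
    rw [e1, h.parabolic p hp hu Φ]
    have hc : ((chiDet L e dV hdV dW hdW χ' p : ℂˣ) : ℂ) = ((θ p : ℂˣ) : ℂ) * ((chiDet L e dV hdV dW hdW χ p : ℂˣ) : ℂ) := by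
      unfold chiDet
      rw [dif_pos hu, dif_pos hu]
      exact hrel p hp hu
    rw [hc]
    ring

/-! ## §4 The determinant twist: `θ = α ∘ det`, `χ' = χ · (α ∘ (d ↦ d / d̄))` -/

section DetTwist

variable {χ χ' : HeckeCharacter L} (α : UnitaryGroup.adelicOne (Fp L) L (IsCMField.complexConj L) →* ℂˣ)

/-- the twisting character `α ∘ det : H(𝔸) →* ℂˣ`. [cite: GelbartRogawski1991, §3.1 Remark p. 457 L9–13] -/
abbrev detChar : HA L e dV hdV dW hdW →* ℂˣ := α.comp (detH L e dV hdV hdV0 dW hdW hdW0)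
/-- `α ∘ det` is continuous for continuous `α`. [cite: GelbartRogawski1991, §3.1 Remark p. 457 L9–13] -/
theorem continuous_coe_detChar (hα : Continuous α) :
    Continuous fun p => ((detChar L e dV hdV hdV0 dW hdW hdW0 α p : ℂˣ) : ℂ) :=
  Units.continuous_val.comp (hα.comp (continuous_detH L e dV hdV hdV0 dW hdW hdW0))

include hdV0 hdW0 in
/-- **the determinant twist of the doubled Weil representation**: if `sD` is `χ`-normalised, `α` is a continuous character of
`U(1)(𝔸_{L⁺})` and `χ'(d) = χ(d) · α(d / d̄)` on `𝕀_L`, then `sD ⊗ (α ∘ det)` is `χ'`-normalised (`det p = x(p) / x(p)‾` on `P_Δ(𝔸)`).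
[cite: GelbartRogawski1991, §3.1 Remark p. 457 L9–13] [cite: Kudla1994, §3] [cite: HarrisKudlaSweet1996, §1 (1.11)–(1.15)] -/
theorem _root_.Literature.NumberTheory.GelbartRogawski1991.GRConstruction.IsDoubledWeilRep.detTwist
    {sD : HA L e dV hdV dW hdW →* MpD L e dV hdV dW hdW} (h : IsDoubledWeilRep L e dV hdV hdV0 dW hdW hdW0 χ sD)
    (hα : Continuous α) (hχ' : ∀ d : ideleGroup L, χ' d = χ d * α (idelesRatio L d)) :
    IsDoubledWeilRep L e dV hdV hdV0 dW hdW hdW0 χ'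
      (adelicMpCont.twist (Fp L) (Fin (n + n)) (gramDA L e dV hdV dW hdW) sD (detChar L e dV hdV hdV0 dW hdW hdW0 α)) :=
  h.twist L e dV hdV hdV0 dW hdW hdW0 _ (continuous_coe_detChar L e dV hdV hdV0 dW hdW hdW0 α hα) fun p hp hu => by
    rw [hχ' hu.unit, Units.val_mul, mul_comm, MonoidHom.comp_apply, detH_eq_idelesRatio_of_isSiegelDelta L e dV hdV hdV0 dW hdW hdW0 p hp hu]

open DoubledWeilUniqueness in
include hdV0 hdW0 in
/-- **[GR91 Remark p. 457] as an identity**: the `χ'`-normalised doubled Weil representation IS the determinant twist of the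
`χ`-normalised one (`χ' = χ · (α ∘ (d ↦ d/d̄))`), by uniqueness (`isDoubledWeilRep_unique`).
[cite: GelbartRogawski1991, §3.1 Remark p. 457 L9–13] [cite: Kudla1994, §3 Thm. 3.1] -/
theorem eq_detTwist {sD sD' : HA L e dV hdV dW hdW →* MpD L e dV hdV dW hdW}
    (h : IsDoubledWeilRep L e dV hdV hdV0 dW hdW hdW0 χ sD) (h' : IsDoubledWeilRep L e dV hdV hdV0 dW hdW hdW0 χ' sD')
    (hα : Continuous α) (hχ' : ∀ d : ideleGroup L, χ' d = χ d * α (idelesRatio L d)) :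
    sD' = adelicMpCont.twist (Fp L) (Fin (n + n)) (gramDA L e dV hdV dW hdW) sD (detChar L e dV hdV hdV0 dW hdW hdW0 α) :=
  isDoubledWeilRep_unique L e dV hdV hdV0 dW hdW hdW0 χ' h' (h.detTwist L e dV hdV hdV0 dW hdW hdW0 α hα hχ')

end DetTwist


/-! ## §5 Undoubling commutes with central twists: `undoubleHom (sD ⊗ θ) = undoubleHom sD ⊗ (θ ∘ inlG)` -/

section Undouble

variable {sD : HA L e dV hdV dW hdW →* MpD L e dV hdV dW hdW}

/-- the central scalars of `Mp(𝕎^𝔻)ᶜᵒⁿᵗ` act as scalars after the undoubling index change. [cite: Kudla1994, §2 (doubled space), §3 Thm. 3.1] -/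
theorem omega_undoubleIdx_ofScalar (c : ℂˣ) (Ψ : piSchwartzBruhat (Fp L) (Fin n ⊕ Fin n)) :
    adelicMpCont.omega (Fp L) (Fin n ⊕ Fin n) (gramS L e dV hdV dW hdW)
        (undoubleIdx L e dV hdV dW hdW (adelicMpCont.ofScalar (Fp L) (Fin (n + n)) (gramDA L e dV hdV dW hdW) c)) Ψ =
      (c : ℂ) • Ψ := by
  show adelicMpCont.omega (Fp L) (Fin n ⊕ Fin n) (gramS L e dV hdV dW hdW)
      (adelicMpContRelabel (Fp L) (Fin n ⊕ Fin n) 1 (gramS_mul_one L e dV hdV dW hdW)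
        (adelicMpContReindex (Fp L) (e₂ (n := n)).symm (gramDA L e dV hdV dW hdW)
          (adelicMpCont.ofScalar (Fp L) (Fin (n + n)) (gramDA L e dV hdV dW hdW) c))) Ψ = _
  rw [adelicMpCont.omega_relabel, adelicMpCont.omega_reindex_apply, adelicMpCont.omega_ofScalar, map_smul,
    LinearEquiv.apply_symm_apply]

/-- the twisted `sD` lies over `ι^𝔻` if `sD` does. [cite: Kudla1994, §2 (doubled space), §3 Thm. 3.1] -/
theorem hproj_twist (hproj : ∀ h, projD L e dV hdV dW hdW (sD h) = toSpD L e dV hdV dW hdW h) (θ : HA L e dV hdV dW hdW →* ℂˣ) :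
    ∀ h, projD L e dV hdV dW hdW (adelicMpCont.twist (Fp L) (Fin (n + n)) (gramDA L e dV hdV dW hdW) sD θ h) =
      toSpD L e dV hdV dW hdW h :=
  fun h => (adelicMpCont.proj_twist sD θ h).trans (hproj h)

include hdV0 hdW0 in
/-- **undoubling commutes with central twists**: `undouble (sD ⊗ θ) g = (1, θ(g ⊕ 1)·id) · undouble sD g` — the right-hand side
lies over `ι(g)` and satisfies the product formula for `u' = undoubleIdx ∘ (sD ⊗ θ) ∘ inlG` (the scalar passes through `undoubleIdx` and
through `Φ₁ ⊠ Φ₂` in the first factor), so it IS `undouble (sD ⊗ θ) g` by `undouble_unique`. [cite: Kudla1994, §2 (doubled space), §3 Thm. 3.1] -/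
theorem undouble_twist (hproj : ∀ h, projD L e dV hdV dW hdW (sD h) = toSpD L e dV hdV dW hdW h) (θ : HA L e dV hdV dW hdW →* ℂˣ)
    (g : UnitaryGroup.adelicPair (Fp L) L (IsCMField.complexConj L) N M (Matrix.diagonal dV) (Matrix.diagonal dW)) :
    undouble L e dV hdV hdV0 dW hdW hdW0 (hproj_twist L e dV hdV dW hdW hproj θ) g =
      adelicMpCont.ofScalar (Fp L) (Fin n) (gramA L e dV hdV dW hdW) (θ (inlG L e dV hdV dW hdW g)) *
        undouble L e dV hdV hdV0 dW hdW hdW0 hproj g := by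
  symm
  refine undouble_unique L e dV hdV hdV0 dW hdW hdW0 (hproj_twist L e dV hdV dW hdW hproj θ) g _ ?_ fun Φ₁ Φ₂ => ?_
  · exact (map_mul (adelicMpCont.proj (Fp L) (Fin n) (gramA L e dV hdV dW hdW)) _ _).trans
      ((congrArg₂ (· * ·) (adelicMpCont.proj_ofScalar (T := gramA L e dV hdV dW hdW) (θ (inlG L e dV hdV dW hdW g)))
        (proj_undouble L e dV hdV hdV0 dW hdW hdW0 hproj g)).trans (one_mul _))
  · -- `u'(g) = undoubleIdx ((1, c) · sD(g ⊕ 1)) = undoubleIdx (1, c) · u(g)`, `c = θ(g ⊕ 1)`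
    have e1 : (uD L e dV hdV dW hdW (adelicMpCont.twist (Fp L) (Fin (n + n)) (gramDA L e dV hdV dW hdW) sD θ) g) = (undoubleIdx L e dV hdV dW hdW (adelicMpCont.ofScalar (Fp L) (Fin (n + n)) (gramDA L e dV hdV dW hdW) (θ (inlG L e dV hdV dW hdW g)))) * (uD L e dV hdV dW hdW sD g) :=
      map_mul (undoubleIdx L e dV hdV dW hdW) _ _
    have s1 : adelicMpCont.omega (Fp L) (Fin n ⊕ Fin n) (gramS L e dV hdV dW hdW) (uD L e dV hdV dW hdW (adelicMpCont.twist (Fp L) (Fin (n + n)) (gramDA L e dV hdV dW hdW) sD θ) g) (tensorToSum (Fp L) (Fin n) (Fin n) Φ₁ Φ₂) = adelicMpCont.omega (Fp L) (Fin n ⊕ Fin n) (gramS L e dV hdV dW hdW) (undoubleIdx L e dV hdV dW hdW (adelicMpCont.ofScalar (Fp L) (Fin (n + n)) (gramDA L e dV hdV dW hdW) (θ (inlG L e dV hdV dW hdW g)))) (adelicMpCont.omega (Fp L) (Fin n ⊕ Fin n) (gramS L e dV hdV dW hdW) (uD L e dV hdV dW hdW sD g) (tensorToSum (Fp L) (Fin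 n) (Fin n) Φ₁ Φ₂)) :=
      (congrArg (fun q => adelicMpCont.omega (Fp L) (Fin n ⊕ Fin n) (gramS L e dV hdV dW hdW) q (tensorToSum (Fp L) (Fin n) (Fin n) Φ₁ Φ₂)) e1).trans
        ((congrArg (fun E : Module.End ℂ (piSchwartzBruhat (Fp L) (Fin n ⊕ Fin n)) => E (tensorToSum (Fp L) (Fin n) (Fin n) Φ₁ Φ₂)) (map_mul (adelicMpCont.omega (Fp L) (Fin n ⊕ Fin n) (gramS L e dV hdV dW hdW)) _ _)).trans
          (Module.End.mul_apply _ _ _))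
    -- the product formula for `u(g)` and the scalar action of `undoubleIdx (1, c)`
    have s2 : adelicMpCont.omega (Fp L) (Fin n ⊕ Fin n) (gramS L e dV hdV dW hdW) (undoubleIdx L e dV hdV dW hdW (adelicMpCont.ofScalar (Fp L) (Fin (n + n)) (gramDA L e dV hdV dW hdW) (θ (inlG L e dV hdV dW hdW g)))) (adelicMpCont.omega (Fp L) (Fin n ⊕ Fin n) (gramS L e dV hdV dW hdW) (uD L e dV hdV dW hdW sD g) (tensorToSum (Fp L) (Fin n) (Fin n) Φ₁ Φ₂)) =
        (((θ (inlG L e dV hdV dW hdW g)) : ℂˣ) : ℂ) • tensorToSum (Fp L) (Fin n) (Fin n) (adelicMpCont.omega (Fp L) (Fin n) (gramA L e dV hdV dW hdW) (undouble L e dV hdV hdV0 dW hdW hdW0 hproj g) Φ₁) Φ₂ :=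
      (congrArg (fun Ψ => adelicMpCont.omega (Fp L) (Fin n ⊕ Fin n) (gramS L e dV hdV dW hdW) (undoubleIdx L e dV hdV dW hdW (adelicMpCont.ofScalar (Fp L) (Fin (n + n)) (gramDA L e dV hdV dW hdW) (θ (inlG L e dV hdV dW hdW g)))) Ψ) (omega_uD_tensorToSum L e dV hdV hdV0 dW hdW hdW0 hproj g Φ₁ Φ₂)).trans
        (omega_undoubleIdx_ofScalar L e dV hdV dW hdW (θ (inlG L e dV hdV dW hdW g)) _)
    -- move the scalar into the first factor, then into `Mp(𝕎)ᶜᵒⁿᵗ`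
    have s3 : (((θ (inlG L e dV hdV dW hdW g)) : ℂˣ) : ℂ) • tensorToSum (Fp L) (Fin n) (Fin n) (adelicMpCont.omega (Fp L) (Fin n) (gramA L e dV hdV dW hdW) (undouble L e dV hdV hdV0 dW hdW hdW0 hproj g) Φ₁) Φ₂ =
        tensorToSum (Fp L) (Fin n) (Fin n) ((((θ (inlG L e dV hdV dW hdW g)) : ℂˣ) : ℂ) • adelicMpCont.omega (Fp L) (Fin n) (gramA L e dV hdV dW hdW) (undouble L e dV hdV hdV0 dW hdW hdW0 hproj g) Φ₁) Φ₂ :=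
      (LinearMap.map_smul₂ (tensorToSum (Fp L) (Fin n) (Fin n)) (((θ (inlG L e dV hdV dW hdW g)) : ℂˣ) : ℂ) (adelicMpCont.omega (Fp L) (Fin n) (gramA L e dV hdV dW hdW) (undouble L e dV hdV hdV0 dW hdW hdW0 hproj g) Φ₁) Φ₂).symm
    have s4 : (((θ (inlG L e dV hdV dW hdW g)) : ℂˣ) : ℂ) • adelicMpCont.omega (Fp L) (Fin n) (gramA L e dV hdV dW hdW) (undouble L e dV hdV hdV0 dW hdW hdW0 hproj g) Φ₁ = adelicMpCont.omega (Fp L) (Fin n) (gramA L e dV hdV dW hdW) ((adelicMpCont.ofScalar (Fp L) (Fin n) (gramA L e dV hdV dW hdW) (θ (inlG L e dV hdV dW hdW g))) * (undouble L e dV hdV hdV0 dW hdW hdW0 hproj g)) Φ₁ :=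
      ((congrArg (fun E : Module.End ℂ (piSchwartzBruhat (Fp L) (Fin n)) => E Φ₁) (map_mul (adelicMpCont.omega (Fp L) (Fin n) (gramA L e dV hdV dW hdW)) (adelicMpCont.ofScalar (Fp L) (Fin n) (gramA L e dV hdV dW hdW) (θ (inlG L e dV hdV dW hdW g))) (undouble L e dV hdV hdV0 dW hdW hdW0 hproj g))).trans
        ((Module.End.mul_apply _ _ _).trans (adelicMpCont.omega_ofScalar (θ (inlG L e dV hdV dW hdW g)) (adelicMpCont.omega (Fp L) (Fin n) (gramA L e dV hdV dW hdW) (undouble L e dV hdV hdV0 dW hdW hdW0 hproj g) Φ₁)))).symm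
    exact s1.trans (s2.trans (s3.trans (congrArg (fun X => tensorToSum (Fp L) (Fin n) (Fin n) X Φ₂) s4)))

include hdV0 hdW0 in
/-- **`undoubleHom (sD ⊗ θ) = undoubleHom sD ⊗ (θ ∘ inlG)`** as homomorphisms `G₁(𝔸) →* Mp(𝕎)ᶜᵒⁿᵗ`.
[cite: Kudla1994, §2 (doubled space), §3 Thm. 3.1] [cite: GelbartRogawski1991, §3.1 Remark p. 457 L4–13] -/
theorem undoubleHom_twist (hproj : ∀ h, projD L e dV hdV dW hdW (sD h) = toSpD L e dV hdV dW hdW h) (θ : HA L e dV hdV dW hdW →* ℂˣ) :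
    undoubleHom L e dV hdV hdV0 dW hdW hdW0 (adelicMpCont.twist (Fp L) (Fin (n + n)) (gramDA L e dV hdV dW hdW) sD θ)
        (hproj_twist L e dV hdV dW hdW hproj θ) =
      adelicMpCont.twist (Fp L) (Fin n) (gramA L e dV hdV dW hdW) (undoubleHom L e dV hdV hdV0 dW hdW hdW0 sD hproj)
        (θ.comp (inlG L e dV hdV dW hdW)) :=
  MonoidHom.ext fun g => undouble_twist L e dV hdV hdV0 dW hdW hdW0 hproj θ g

end Undouble


/-! ## §6 The twisted character `χ · (α ∘ (d ↦ d / d̄))` is a Hecke character for automorphic `α` -/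

section RatioHecke

variable (α : UnitaryGroup.adelicOne (Fp L) L (IsCMField.complexConj L) →* ℂˣ)

/-- `d̄ = c • d` (the idele-level Galois action of record). [cite: GelbartRogawski1991, §3.1 Remark p. 457 L4–13] -/
theorem conjIdele_eq_smul (d : ideleGroup L) : conjIdele L d = IsCMField.complexConj L • d := Units.ext rfl

/-- the ratio of a principal idele is principal: `(k)/(k)‾ = (k / k̄)`. [cite: GelbartRogawski1991, §3.1 Remark p. 457 L4–13] -/
theorem coe_idelesRatio_mem_principalIdeles {x : ideleGroup L} (hx : x ∈ principalIdeles L) :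
    ((idelesRatio L x : UnitaryGroup.adelicOne (Fp L) L (IsCMField.complexConj L)) : ideleGroup L) ∈ principalIdeles L := by
  obtain ⟨k, rfl⟩ := hx
  refine ⟨k / Units.map ((IsCMField.complexConj L : L ≃ₐ[Fp L] L) : L →+* L).toMonoidHom k, ?_⟩
  rw [map_div, coe_idelesRatio]
  congr 1
  exact Units.ext (UnitaryGroup.algebraMap_conj (Fp L) L (IsCMField.complexConj L) (k : L))

/-- the ratio of an `L⁺`-idele is trivial: `d̄ = d` on `𝕀_{L⁺} ⊂ 𝕀_L`. [cite: HarrisKudlaSweet1996, §1 (1.5) p. 951] -/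
theorem idelesRatio_ideleBaseChange (x : ideleGroup (Fp L)) :
    idelesRatio L (AdeleRing.ideleBaseChange (Fp L) L x) = 1 := by
  apply Subtype.ext
  rw [coe_idelesRatio, conjIdele_eq_smul, AdeleRing.smul_ideleBaseChange, div_self']
  rfl

/-- **the character `d ↦ α(d / d̄)` of `𝕀_L`** for a continuous character `α` of `U(1)(𝔸_{L⁺})`, as a continuous
homomorphism. [cite: GelbartRogawski1991, §3.1 Remark p. 457 L4–13] -/
def ratioCharCont (hα : Continuous α) : ideleGroup L →ₜ* ℂˣ where
  toMonoidHom := α.comp (idelesRatio L)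
  continuous_toFun := hα.comp (continuous_idelesRatio L)

/-- formula. [cite: GelbartRogawski1991, §3.1 Remark p. 457 L4–13] -/
@[simp] theorem ratioCharCont_apply (hα : Continuous α) (d : ideleGroup L) :
    ratioCharCont L α hα d = α (idelesRatio L d) := rfl

/-- **`d ↦ α(d / d̄)` is a Hecke character** when `α` is AUTOMORPHIC, i.e. trivial on the principal norm-one ideles (the `(k / k̄)`,
`k ∈ Lˣ`, by Hilbert 90; only the easy inclusion is used) — the `α̃` of [GelbartRogawski1991, §3.1 Remark p. 457] («a choice of `s` is
equivalent to a choice of Hecke character of `E`»); cf. `Arthur2013.Leaves.TECR.TorusDict.pullback` for the torus model `ker N`.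
[cite: GelbartRogawski1991, §3.1 Remark p. 457 L4–13] -/
def ratioHecke (hα : Continuous α)
    (hαrat : ∀ u : UnitaryGroup.adelicOne (Fp L) L (IsCMField.complexConj L), (u : ideleGroup L) ∈ principalIdeles L → α u = 1) :
    HeckeCharacter L where
  toContinuousMonoidHom := ratioCharCont L α hα
  map_principal' _ hx := hαrat _ (coe_idelesRatio_mem_principalIdeles L hx)

variable {α}
/-- formula. [cite: GelbartRogawski1991, §3.1 Remark p. 457 L4–13] -/
@[simp] theorem ratioHecke_apply (hα : Continuous α)
    (hαrat : ∀ u : UnitaryGroup.adelicOne (Fp L) L (IsCMField.complexConj L), (u : ideleGroup L) ∈ principalIdeles L → α u = 1)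
    (d : ideleGroup L) : ratioHecke L α hα hαrat d = α (idelesRatio L d) := rfl

/-- the twisted character `χ' = χ · α̃` satisfies the relation of `IsDoubledWeilRep.detTwist`. [cite: GelbartRogawski1991, §3.1 Remark p. 457 L4–13] -/
theorem mul_ratioHecke_apply (χ : HeckeCharacter L) (hα : Continuous α)
    (hαrat : ∀ u : UnitaryGroup.adelicOne (Fp L) L (IsCMField.complexConj L), (u : ideleGroup L) ∈ principalIdeles L → α u = 1)
    (d : ideleGroup L) : (χ * ratioHecke L α hα hαrat) d = χ d * α (idelesRatio L d) := rfl

/-- **`α̃` is trivial on `𝕀_{L⁺}`**, so twisting by it preserves the splitting condition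
`χ|_{𝕀_{L⁺}} = ε^m` of [HarrisKudlaSweet1996, (1.5)]. [cite: HarrisKudlaSweet1996, §1 (1.5) p. 951] -/
theorem isSplittingChar_mul_ratioHecke_iff (m : ℕ) (χ : HeckeCharacter L) (hα : Continuous α)
    (hαrat : ∀ u : UnitaryGroup.adelicOne (Fp L) L (IsCMField.complexConj L), (u : ideleGroup L) ∈ principalIdeles L → α u = 1) :
    IsSplittingChar L m (χ * ratioHecke L α hα hαrat) ↔ IsSplittingChar L m χ := by
  refine forall_congr' fun x => ?_
  rw [mul_ratioHecke_apply, idelesRatio_ideleBaseChange, map_one, mul_one]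

/-- twisting by a unitary `α` preserves unitarity. [cite: GelbartRogawski1991, §3.1 Remark p. 457 L4–13] -/
theorem isUnitary_mul_ratioHecke {χ : HeckeCharacter L} (hχu : χ.IsUnitary) (hα : Continuous α)
    (hαrat : ∀ u : UnitaryGroup.adelicOne (Fp L) L (IsCMField.complexConj L), (u : ideleGroup L) ∈ principalIdeles L → α u = 1)
    (hαu : ∀ u, ‖((α u : ℂˣ) : ℂ)‖ = 1) : (χ * ratioHecke L α hα hαrat).IsUnitary := fun d => by
  rw [mul_ratioHecke_apply, Units.val_mul, norm_mul, hχu d, hαu, mul_one]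

end RatioHecke

end DoubledWeilDetTwist

/-! ### Build-lane note (ops-buildfix G11b-3 / B13-1 recipe): the public theorems with the dual-pair telescope in their statements
are tagged `[implicit_reducible]` purely to keep them out of the hub build lane's library-suggestion index (inert otherwise). -/
set_option allowUnsafeReducibility true in
attribute [implicit_reducible] DoubledWeilDetTwist.det_hermD_ne_zero DoubledWeilDetTwist.coe_coe_detH DoubledWeilDetTwist.continuous_detH
  DoubledWeilDetTwist.isUnit_det_reindex_pairFormA DoubledWeilDetTwist.det_mul_conjAdele_detDelta
  DoubledWeilDetTwist.detH_eq_idelesRatio_of_isSiegelDelta DoubledWeilDetTwist.coe_detH_inlG IsDoubledWeilRep.twist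
  DoubledWeilDetTwist.continuous_coe_detChar IsDoubledWeilRep.detTwist DoubledWeilDetTwist.eq_detTwist
  DoubledWeilDetTwist.omega_undoubleIdx_ofScalar DoubledWeilDetTwist.hproj_twist DoubledWeilDetTwist.undouble_twist
  DoubledWeilDetTwist.undoubleHom_twist

end Literature.NumberTheory.GelbartRogawski1991.GRConstruction

end
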